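import Mathlib
import Summits.QuantumAdvantage.QuantumAdvantage.Theses.WhiteBoxWalk
import Summits.QuantumAdvantage.QuantumAdvantage.Theorems.WbwVerifiableLineNoSpeedup.Negative.LoadBearing
import Summits.QuantumAdvantage.QuantumAdvantage.Theorems.WbwVerifiableLineNoSpeedup.Negative.Tightness
import Summits.QuantumAdvantage.QuantumAdvantage.Theorems.WbwVerifiableLineNoSpeedup.Negative.Padding
import Summits.QuantumAdvantage.QuantumAdvantage.Theorems.WbwVerifiableLineNoSpeedup.Negative.WeightedAdversary
import Summits.QuantumAdvantage.QuantumAdvantage.Theorems.WbwVerifiableLineNoSpeedup.Negative.WeightedAdversaryBound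
import Summits.QuantumAdvantage.QuantumAdvantage.Theorems.WbwVerifiableLineNoSpeedup.Negative.PermInstances
import Summits.QuantumAdvantage.QuantumAdvantage.Theorems.WbwVerifiableLineNoSpeedup.Negative.PermClosure
import Summits.QuantumAdvantage.QuantumAdvantage.Theorems.WbwVerifiableLineNoSpeedup.Negative.AdversaryDatum
import Literature.Computability.QuantumComplexity.SinkOfVerifiableLine
import Literature.Computability.QuantumComplexity.ExactQuantumQuery

/-!
# Skeleton line `swap-relational-adversary` for the crux `WhiteBoxWalk.WbwVerifiableLineNoSpeedup`
(stmt-QuantumAdvantage-2239) — crux-plan, round 1, GENERATION 2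

THE CRUX (`Negative.crux_iff`, `Iff.rfl`):
`∃ c > 0, ∀ m T, 2 ≤ m → 1 ≤ T → T + 1 ≤ 2^(m-1) → c · min (T+1) √(2^m) / m ≤ Q_{1/3}(SVL_{m,T})`,
`Q_{1/3}(SVL_{m,T}) = svlQ m T = quantumQueryComplexityOn (1/3) (svlPromise m T) (svlSinkBit m T)`.

THE LINE (idea card `Ideas/swap-relational-adversary.md`; triage `TRIAGE-r1-{1,2,3}.md`: pass ×3 — "same
lever as cycle-surgery-adversary = Disproof §7; take the family `P'_T` (all cycles `> T`), `8T ≤ 2^m`,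
large `T` by `PaddingMonotone`, ONE packaging of the adversary theorem"): Ambainis's weighted relational
adversary fed with the TWO-POINT TARGET SWAP `σ' = σ * swap(x_k, v)` on long-cycle PERMUTATION instances —
related tables differ in two S-rows and the `2(T-k)` tail V-cells, and every differing position is cheap on
at most ONE side ("a pointer is free to verify, costs `1/T` to locate and `1/N` to aim"). `N = 2^m` below.

WHAT GENERATION 2 CHANGES (everything re-cut on what LANDED in `Theorems/…/Negative/` after the cards
and gen 1 were written; gen 1 = commit abc3f4fe93f5, 4 stubs):
* The adversary theorem is LANDED (`Negative/WeightedAdversaryBound.lean`, p76656: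
  `WeightedAdversary.sqrt_le_quantumQueryComplexityOn` — Ambainis 2002 Thm 6, min-degree form, promise
  version, constant 144). Gen 1's `stub_relationalAdversary` is therefore NOT a stub any more: §4 calls
  the landed theorem directly. THREE stubs remain, all finite permutation combinatorics.
* The family and relation are stated over the LANDED vocabulary of `Negative/PermInstances.lean` (p76682)
  — `permInput`, `permLine`, `NoReturn` (= `P'_T`), `transpose σ u v = σ * swap u v`, `src0` — instead of
  gen 1's private copies, so the stubs speak about the very objects of the disprover's landing lane
  (`AdversaryDatum → Line → Counts → Bound`, p77173 pending) and of `Negative/PermClosure.lean` (p76790: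
  `noReturn_transpose` — the family IS closed under long merges / far splits, PROVED; imported here).
* BRIDGE to the landed adversary DATUM (`Negative/AdversaryDatum.lean`, p77173 — accepted 03:31Z while
  this plan was being written: `Adversary.LC`, `Xp`, `Yp`, `Adj`, `Rp`, `shift`, `card_filter_image_fst`):
  `isSwap_iff_adj` (`IsSwap` = both in `P'_T` + `Adj`), `famX_eq_image_Xp`, `famY_eq_image_Yp`,
  `rel_eq_image_Rp` (`rel` = image of `Rp` under `permInput × permInput`), and the permutation-level
  readings `ldeg_eq_card_Rp`, `rdeg_eq_card_Rp`, `l1_eq_card_Rp`, `l2_eq_card_Rp` — so every count the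
  disprover's lane (`AdversaryLine/Acquire/Degree`) lands over `Rp`/`Xp`/`Yp` discharges the matching
  stub below by rewriting, and conversely; the landed `Adversary.noReturn_shift` is the `N`-cycle of
  stub B's nonemptiness clause.
* The SWAP ANATOMY — the core of the hardest stub, which gen 1's card listed as "not in the tree or Mathlib
  in this form" — is now PROVED in this file from the landed prefix/continuation lemmas: `pt_transpose_of_le`
  (lines agree up to the cut), `pt_transpose_add` (after the cut the new line reads `σ v, σ² v, …, σ^(T-k) v`,
  uniformly in the merge and the split case, because both permutations are in `P'_T`), `pt_transpose_ne`
  (they differ at every later level), `sink_transpose` (new sink `= σ^(T-k) v`), `target_eq_of_pt_eq`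
  (the target is DETERMINED by the cut once the new line is to pass through a given cell — the heart of
  the acquisition count), `transpose_params_unique` (distinct `(k, v)` give distinct partners),
  `target_off_line` / `target_off_new_line` (a legal target is off BOTH lines up to level `T`: a target
  `x_q`, `q ≤ T`, would excise a cycle of length `≤ T`), `succ_ne_imp` (S-bits differ only in rows `x_k`,
  `v`), `verify_ne_imp` (V-bits differ only at cells `(x_j, j)`, `(x'_j, j)` with `j > k`), and the
  total-degree bounds `ldeg_le` / `rdeg_le` (`≤ T·N` partners on either side). What is left in the
  three stubs is exactly the three COUNTS.

* family: `σ ∈ P'_T` ⇔ `NoReturn T σ`; instance `permInput T σ = (σ, [x = σ^i 0])`; line `pt σ i = σ^i(0)`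
  (`= permLine T σ i`); value `sinkOdd T σ` = parity of `pt σ T`.
* relation `IsSwap T σ σ'` (§1): both in `P'_T` and `σ' = transpose σ (pt σ k) v` for a cut `k < T` and a
  target `v ∉ {x_0, …, x_k}`; symmetric (`isSwap_symm`, proved). `rel m T` = the swap pairs
  (even sink, odd sink) as pairs of input strings; `famX` / `famY` = family instances with even / odd sink.

STUBS (registered; the only `sorry`s of the file; convention as in the sibling lines: the statement of each
stub is the `Prop` `Sig.stub_<name>`, the obligation is `theorem stub_<name> : Sig.stub_<name> := by sorry`,
and `WbwVerifiableLineNoSpeedup_of` takes the three signatures as hypotheses BY NAME):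
* `stub_swapDegrees` (B, size M): for `1 ≤ T`, `8T ≤ N`: both sides nonempty, every family instance has
  `≥ T·N/8` partners of the opposite sink parity (per cut the new sinks `σ^{T-k}(v)` — `sink_transpose` —
  run injectively over `[N] ∖ {x_0..x_{2T}}`; family preservation = landed `noReturn_transpose`).
* `stub_swapRows` (C_S, size M): at a differing S-table bit the Ambainis product is `≤ N²` (`succ_ne_imp`:
  only rows `x_k`, `v` differ; row `x_k`: `≤ N` partners on either side; row `v`: `≤ T`).
* `stub_swapCells` (C_V, size M, HARDEST): at a differing V-table bit `(w, j)` the product is `≤ 4T²N`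
  (`verify_ne_imp`: `j > k`, `w ∈ {x_j, x'_j}`; the marked side has `≤ T·N` partners at all — `ldeg_le` /
  `rdeg_le`; the other side ACQUIRES `w` at level `j` through at most ONE target per cut `k' < j`, namely
  `v' = σ^{-(j-k')}(w)` by `pt_transpose_add` — so `≤ j ≤ T`).
PROVED HERE (no sorry): §1 (family/relation API, anatomy, well-formedness), §2 (degree bookkeeping,
`ldeg_le`, `rdeg_le`), `productBound_of` (C_S + C_V ⇒ the per-pair hypothesis at EVERY input bit),
`smallT_of_stubs` (B + C_S + C_V + the LANDED adversary theorem ⇒ Disproof's Target A `SvlAdversarySmallT`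
with `κ = 1/2304`), `crux_of_smallT` (Disproof §7.3's checked reduction with the padding hypothesis
discharged by the LANDED `SvlPadding.quantumQueryComplexityOn_svl_pad`, small `m` by the LANDED
`Negative.one_le_svlQ_of_hyps`), and the composition `WbwVerifiableLineNoSpeedup_of`.

DISPROOF USED (Disproof.lean gen 1 cycle 1; Negative/* imported): `_false_without_Tpos` honoured — `1 ≤ T`
is used by stub B (a cut exists; `dstar > 0` makes `rel` nonempty) and by `Q ≥ 1` in §5;
`_false_without_Tbound` honoured — `T + 1 ≤ 2^(m-1)` is used in §5 exactly as in the disprover's checked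
reduction; `admissible_const_le_one` / `not_groverBranchOnly` / `SvlGrover.not_walkBranchOnly` respected
(`c ≤ 1/4`; the bound keeps the `min`: walk branch from row `x_k`, Grover branch from the V-cells); §6.3's
"accidental hits" gap closed (under the swap relation the old tail rows are NOT differing positions); §6.4
evaded (many-input relational method); §7 targets: `WeightedAdversaryBound` LANDED, `PaddingMonotone`
LANDED, `SvlAdversarySmallT` PROVED FROM THE STUBS here. No landed Negative lemma refutes any stub.
-/

noncomputable section

set_option linter.dupNamespace false
set_option linter.unusedVariables false
set_option linter.unusedSectionVars false

namespace Summit.QuantumAdvantage.QuantumAdvantage.Cruxes.WbwVerifiableLineNoSpeedup.SwapRelationalAdversary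

open Literature.Computability.Cryptography Literature.Computability.QuantumComplexity
  Literature.Computability.Complexity
open Summit.QuantumAdvantage.QuantumAdvantage.Theses.WhiteBoxWalk (WbwVerifiableLineNoSpeedup)
open Summit.QuantumAdvantage.QuantumAdvantage.Theorems.WbwVerifiableLineNoSpeedup.Negative
open Summit.QuantumAdvantage.QuantumAdvantage.Theorems.WbwVerifiableLineNoSpeedup.Negative.WeightedAdversary
  (Rel l1 l2 sqrt_le_quantumQueryComplexityOn)
open Summit.QuantumAdvantage.QuantumAdvantage.Theorems.WbwVerifiableLineNoSpeedup.Negative.PermInstances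
open Summit.QuantumAdvantage.QuantumAdvantage.Theorems.WbwVerifiableLineNoSpeedup.Negative.Adversary
open Summit.QuantumAdvantage.QuantumAdvantage.Theorems.WbwVerifiableLineNoSpeedup.Negative.SvlPadding
  (quantumQueryComplexityOn_svl_pad)

/-! ## §1 The hard instances (`P'_T` = `NoReturn T`, landed) and the two-point swap relation -/

section Family

variable {m T : ℕ}

/-- The `i`-th point `x_i = σ^i(0)` of the orbit of the source, for any `i : ℕ`
(`= permLine T σ i` for `i ≤ T`, by `rfl`). -/
def pt (σ : Equiv.Perm (Fin (2 ^ m))) (i : ℕ) : Fin (2 ^ m) := (σ ^ i) (src0 m)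

/-- The landed line is `pt` (definitional). -/
theorem permLine_eq_pt (σ : Equiv.Perm (Fin (2 ^ m))) (i : Fin (T + 1)) :
    permLine T σ i = pt σ i.val := rfl

/-- The parity of the sink `x_T = σ^T(0)` (the function value of the instance of `σ`). -/
def sinkOdd (T : ℕ) (σ : Equiv.Perm (Fin (2 ^ m))) : Bool := decide ((pt σ T).val % 2 = 1)

/-- **The two-point target-swap relation** (card `swap-relational-adversary`, Mechanism; Disproof §7.1's
"output transposition"): `σ' = transpose σ x_k v = σ * swap(x_k, v)`, i.e. `σ'(x_k) = σ(v)`,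
`σ'(v) = σ(x_k) = x_{k+1}`, all other rows equal, for a cut `k < T` and a target `v ∉ {x_0, …, x_k}`, BOTH
permutations in `P'_T = NoReturn T` (this forces a long merge or a far split and puts `v` off both lines).
Symmetric: `isSwap_symm`. -/
def IsSwap (T : ℕ) (σ σ' : Equiv.Perm (Fin (2 ^ m))) : Prop :=
  NoReturn T σ ∧ NoReturn T σ' ∧
    ∃ k : ℕ, k < T ∧ ∃ v : Fin (2 ^ m), (∀ i : ℕ, i ≤ k → v ≠ pt σ i) ∧ σ' = transpose σ (pt σ k) v

open scoped Classical in
/-- `X` = the instances of family members with EVEN sink. -/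
def famX (m T : ℕ) : Finset (SVLInput m T) :=
  (Finset.univ.filter fun σ : Equiv.Perm (Fin (2 ^ m)) =>
      NoReturn T σ ∧ sinkOdd T σ = false).image (permInput T)

open scoped Classical in
/-- `Y` = the instances of family members with ODD sink. -/
def famY (m T : ℕ) : Finset (SVLInput m T) :=
  (Finset.univ.filter fun σ : Equiv.Perm (Fin (2 ^ m)) =>
      NoReturn T σ ∧ sinkOdd T σ = true).image (permInput T)

open scoped Classical in
/-- `R ⊆ X × Y` = the swap pairs (even sink, odd sink), as pairs of input strings
(an element of the landed `WeightedAdversary.Rel`). -/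
def rel (m T : ℕ) : Finset (SVLInput m T × SVLInput m T) :=
  (Finset.univ.filter fun p : Equiv.Perm (Fin (2 ^ m)) × Equiv.Perm (Fin (2 ^ m)) =>
      IsSwap T p.1 p.2 ∧ sinkOdd T p.1 = false ∧ sinkOdd T p.2 = true).image
    fun p => (permInput T p.1, permInput T p.2)

/-! ### Orbit API (proved) -/

theorem pt_zero (σ : Equiv.Perm (Fin (2 ^ m))) : pt σ 0 = src0 m := by
  simp [pt]

theorem pt_succ (σ : Equiv.Perm (Fin (2 ^ m))) (i : ℕ) : pt σ (i + 1) = σ (pt σ i) := by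
  simp [pt, pow_succ', Equiv.Perm.mul_apply]

theorem pt_add (σ : Equiv.Perm (Fin (2 ^ m))) (i j : ℕ) : pt σ (i + j) = (σ ^ j) (pt σ i) := by
  rw [pt, add_comm, pow_add, Equiv.Perm.mul_apply]
  rfl

/-- In `P'_T` (indeed as soon as the source does not return) the points `x_0, …, x_T` are pairwise
distinct. -/
theorem pt_injOn {σ : Equiv.Perm (Fin (2 ^ m))} (hσ : NoReturnAtZero T σ) {i j : ℕ} (hi : i ≤ T)
    (hj : j ≤ T) (h : pt σ i = pt σ j) : i = j := by
  have h' : permLine T σ ⟨i, Nat.lt_succ_of_le hi⟩ = permLine T σ ⟨j, Nat.lt_succ_of_le hj⟩ := h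
  exact (Fin.mk.inj_iff).1 (permLine_injective hσ h')

/-- The lines of `σ` and of `transpose σ x_k v` (`k ≤ T`, `v ∉ {x_0, …, x_k}`, source not returning)
agree up to position `k` (landed `permLine_transpose_eq` + `prefix_ne_of_noReturnAtZero`). -/
theorem pt_transpose_of_le {σ : Equiv.Perm (Fin (2 ^ m))} (hσ : NoReturnAtZero T σ) {k : ℕ}
    (hk : k ≤ T) {v : Fin (2 ^ m)} (hv : ∀ i : ℕ, i ≤ k → v ≠ pt σ i) :
    ∀ i : ℕ, i ≤ k → pt (transpose σ (pt σ k) v) i = pt σ i :=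
  permLine_transpose_eq (prefix_ne_of_noReturnAtZero hσ hk) fun j hj h => hv j hj.le h.symm

/-- **The swap relation is symmetric (proved, no stub)**: `transpose` is an involution
(`transpose_transpose`), the cut point `x_k = x'_k` is common to both lines and
`v ∉ {x'_0, …, x'_k} = {x_0, …, x_k}`. -/
theorem isSwap_symm {σ σ' : Equiv.Perm (Fin (2 ^ m))} (h : IsSwap T σ σ') : IsSwap T σ' σ := by
  obtain ⟨hσ, hσ', k, hk, v, hv, rfl⟩ := h
  have hagree := pt_transpose_of_le hσ.atZero hk.le hv
  refine ⟨hσ', hσ, k, hk, v, fun i hi => ?_, ?_⟩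
  · rw [hagree i hi]
    exact hv i hi
  · rw [hagree k le_rfl, transpose_transpose]

/-- **Swap anatomy (proved)**: for a related pair `(σ, σ' = transpose σ x_k v)` — both in `P'_T` — the
new line reads `x'_{k+i} = σ^i(v)` for `1 ≤ i ≤ T - k`, uniformly in the merge case (`v` on another
cycle) and the split case (`v = x_q`: `σ' ∈ P'_T` forbids the wrap). This is the landed continuation lemma
`permLine_transpose_add` with its avoidance hypothesis discharged by `NoReturn`: the `σ`-orbit of `v`
cannot return to `v` within `T` steps (`σ ∈ P'_T`), and cannot hit `x_k = x'_k` before level `T` either,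
since that would make the source of `σ'` return (`σ' ∈ P'_T`). -/
theorem pt_transpose_add {σ : Equiv.Perm (Fin (2 ^ m))} (hσ : NoReturn T σ) {k : ℕ} (hk : k ≤ T)
    {v : Fin (2 ^ m)} (hv : ∀ i : ℕ, i ≤ k → v ≠ pt σ i)
    (hτ : NoReturn T (transpose σ (pt σ k) v)) :
    ∀ i : ℕ, 1 ≤ i → k + i ≤ T → pt (transpose σ (pt σ k) v) (k + i) = (σ ^ i) v := by
  have hagree : pt (transpose σ (pt σ k) v) k = pt σ k :=
    pt_transpose_of_le hσ.atZero hk hv k le_rfl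
  intro i
  induction i with
  | zero => intro h; omega
  | succ i ih =>
    intro _ hi
    rw [← add_assoc, pt_succ]
    rcases Nat.eq_zero_or_pos i with rfl | hpos
    · rw [add_zero, hagree, pow_one]
      exact transpose_apply_left σ (pt σ k) v
    · rw [ih hpos (by omega), pow_succ', Equiv.Perm.mul_apply]
      apply transpose_apply_of_ne
      · -- `σ^i v ≠ x_k`: else the source of `σ'` would return at level `k + i ≤ T`
        intro heq
        have h1 : pt (transpose σ (pt σ k) v) (k + i) = pt (transpose σ (pt σ k) v) k := by
          rw [ih hpos (by omega), heq, hagree]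
        have h2 : ((transpose σ (pt σ k) v) ^ i) (pt (transpose σ (pt σ k) v) k) =
            pt (transpose σ (pt σ k) v) k := by
          rw [← pt_add]
          exact h1
        exact hτ _ i hpos (by omega) h2
      · -- `σ^i v ≠ v`: `σ ∈ P'_T`
        exact hσ v i hpos (by omega)

/-- Hence the two lines DIFFER at every level after the cut (`v ≠ x_k`). -/
theorem pt_transpose_ne {σ : Equiv.Perm (Fin (2 ^ m))} (hσ : NoReturn T σ) {k : ℕ} (hk : k ≤ T)
    {v : Fin (2 ^ m)} (hv : ∀ i : ℕ, i ≤ k → v ≠ pt σ i)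
    (hτ : NoReturn T (transpose σ (pt σ k) v)) {j : ℕ} (hkj : k < j) (hj : j ≤ T) :
    pt (transpose σ (pt σ k) v) j ≠ pt σ j := by
  obtain ⟨i, rfl⟩ : ∃ i, j = k + i := ⟨j - k, by omega⟩
  rw [pt_transpose_add hσ hk hv hτ i (by omega) hj, pt_add]
  intro h
  exact hv k le_rfl ((σ ^ i).injective h)

/-- And the new SINK is `σ^(T-k)(v)` (the bijection `v ↦ new sink` behind the degree count). -/
theorem sink_transpose {σ : Equiv.Perm (Fin (2 ^ m))} (hσ : NoReturn T σ) {k : ℕ} (hk : k < T)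
    {v : Fin (2 ^ m)} (hv : ∀ i : ℕ, i ≤ k → v ≠ pt σ i)
    (hτ : NoReturn T (transpose σ (pt σ k) v)) :
    pt (transpose σ (pt σ k) v) T = (σ ^ (T - k)) v := by
  have h := pt_transpose_add hσ hk.le hv hτ (T - k) (by omega) (by omega)
  rwa [show k + (T - k) = T by omega] at h

/-- **The target is determined by the cut (proved)** — the heart of the ACQUISITION count of stub C_V:
if the partner's line passes through `w` at a level `j > k`, then `v = σ^{-(j-k)}(w)`. -/
theorem target_eq_of_pt_eq {σ : Equiv.Perm (Fin (2 ^ m))} (hσ : NoReturn T σ) {k : ℕ}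
    {v : Fin (2 ^ m)} (hv : ∀ i : ℕ, i ≤ k → v ≠ pt σ i)
    (hτ : NoReturn T (transpose σ (pt σ k) v)) {j : ℕ} (hkj : k < j) (hj : j ≤ T) {w : Fin (2 ^ m)}
    (hw : pt (transpose σ (pt σ k) v) j = w) : v = (σ ^ (j - k)).symm w := by
  obtain ⟨i, rfl⟩ : ∃ i, j = k + i := ⟨j - k, by omega⟩
  rw [pt_transpose_add hσ (by omega) hv hτ i (by omega) hj] at hw
  rw [show k + i - k = i by omega, Equiv.eq_symm_apply]
  exact hw

/-- **Distinct parameters give distinct partners (proved)**: the cut and the target are determined by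
the partner (`σ⁻¹ σ' = swap(x_k, v)` with `x_k` on the line and `v` off its first `k + 1` points). The
injectivity behind "`T` cuts × (`≥ N/8` targets each)" in stub B. -/
theorem transpose_params_unique {σ : Equiv.Perm (Fin (2 ^ m))} (hσ : NoReturnAtZero T σ)
    {k k' : ℕ} (hk : k ≤ T) (hk' : k' ≤ T) {v v' : Fin (2 ^ m)}
    (hv : ∀ i : ℕ, i ≤ k → v ≠ pt σ i) (hv' : ∀ i : ℕ, i ≤ k' → v' ≠ pt σ i)
    (h : transpose σ (pt σ k) v = transpose σ (pt σ k') v') : k = k' ∧ v = v' := by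
  have h' : σ * Equiv.swap (pt σ k) v = σ * Equiv.swap (pt σ k') v' := h
  have hswap : Equiv.swap (pt σ k) v = Equiv.swap (pt σ k') v' := mul_left_cancel h'
  -- evaluate both swaps at `x_k`
  have h1 : Equiv.swap (pt σ k') v' (pt σ k) = v := by
    rw [← hswap, Equiv.swap_apply_left]
  by_cases hkk : pt σ k = pt σ k'
  · have hkeq : k = k' := pt_injOn hσ hk hk' hkk
    subst hkeq
    refine ⟨rfl, ?_⟩
    rw [Equiv.swap_apply_left] at h1
    exact h1.symm
  · by_cases hkv : pt σ k = v'
    · -- then `x_{k'} = v` and `x_k = v'`: impossible by the side conditions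
      rw [hkv, Equiv.swap_apply_right] at h1
      exfalso
      rcases le_or_gt k' k with hle | hlt
      · exact hv k' hle h1.symm
      · exact hv' k hlt.le hkv.symm
    · rw [Equiv.swap_apply_of_ne_of_ne hkk hkv] at h1
      exact absurd h1.symm (hv k le_rfl)

/-- **A legal target is off the whole line (proved)**: if `transpose σ x_k v ∈ P'_T` then
`v ∉ {x_0, …, x_T}` — a target `v = x_q` with `k < q ≤ T` would excise the short cycle
`(x_{k+1} … x_q)` of length `q - k ≤ T`. (Row `v` carries no cut point — stub C_S; far splits only —
stub B.) -/
theorem target_off_line {σ : Equiv.Perm (Fin (2 ^ m))} (hσ : NoReturnAtZero T σ) {k : ℕ}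
    (hk : k < T) {v : Fin (2 ^ m)} (hv : ∀ i : ℕ, i ≤ k → v ≠ pt σ i)
    (hτ : NoReturn T (transpose σ (pt σ k) v)) : ∀ q : ℕ, q ≤ T → v ≠ pt σ q := by
  intro q hq hvq
  have hkq : k < q := by
    by_contra h
    push Not at h
    exact hv q h hvq
  subst hvq
  -- along `x_{k+1}, …, x_{q-1}` the transposed permutation walks like `σ`
  have hwalk : ∀ s : ℕ, s ≤ q - k - 1 →
      ((transpose σ (pt σ k) (pt σ q)) ^ s) (pt σ (k + 1)) = pt σ (k + 1 + s) := by
    intro s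
    induction s with
    | zero => intro; simp
    | succ s ih =>
      intro hs
      rw [pow_succ', Equiv.Perm.mul_apply, ih (by omega), ← add_assoc, pt_succ σ (k + 1 + s)]
      apply transpose_apply_of_ne
      · intro h
        have h' := pt_injOn hσ (by omega : k + 1 + s ≤ T) hk.le h
        omega
      · intro h
        have h' := pt_injOn hσ (by omega : k + 1 + s ≤ T) hq h
        omega
  -- hence `x_q` returns to itself after `q - k ≤ T` steps: the partner is not in `P'_T`
  have h1 : transpose σ (pt σ k) (pt σ q) (pt σ q) = pt σ (k + 1) := by
    rw [transpose_apply_right, ← pt_succ]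
  have hret : ((transpose σ (pt σ k) (pt σ q)) ^ (q - k)) (pt σ q) = pt σ q := by
    calc ((transpose σ (pt σ k) (pt σ q)) ^ (q - k)) (pt σ q)
        = ((transpose σ (pt σ k) (pt σ q)) ^ (q - k - 1))
            (transpose σ (pt σ k) (pt σ q) (pt σ q)) := by
          rw [← Equiv.Perm.mul_apply, ← pow_succ, show q - k - 1 + 1 = q - k by omega]
      _ = pt σ (k + 1 + (q - k - 1)) := by rw [h1, hwalk _ le_rfl]
      _ = pt σ q := by congr 1; omega
  exact hτ (pt σ q) (q - k) (by omega) (by omega) hret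

/-- … and off the NEW line as well: `v ≠ x'_i` for all `i ≤ T` (prefix by `hv`, tail because
`x'_{k+i} = σ^i v ≠ v` in `P'_T`). (Row `v` carries no cut point on either side — stub C_S.) -/
theorem target_off_new_line {σ : Equiv.Perm (Fin (2 ^ m))} (hσ : NoReturn T σ) {k : ℕ} (hk : k ≤ T)
    {v : Fin (2 ^ m)} (hv : ∀ i : ℕ, i ≤ k → v ≠ pt σ i)
    (hτ : NoReturn T (transpose σ (pt σ k) v)) :
    ∀ i : ℕ, i ≤ T → v ≠ pt (transpose σ (pt σ k) v) i := by
  intro i hi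
  rcases le_or_gt i k with hik | hki
  · rw [pt_transpose_of_le hσ.atZero hk hv i hik]
    exact hv i hik
  · obtain ⟨j, rfl⟩ : ∃ j, i = k + j := ⟨i - k, by omega⟩
    rw [pt_transpose_add hσ hk hv hτ j (by omega) hi]
    exact (hσ v j (by omega) (by omega)).symm

/-! ### Reading the instances (landed `permInput` API) and well-formedness of the relation (proved) -/

/-- A family member's instance lies in the promise set. -/
theorem permInput_mem_of_noReturn {σ : Equiv.Perm (Fin (2 ^ m))} (hσ : NoReturn T σ) :
    permInput T σ ∈ svlPromise m T :=
  permInput_mem hσ.atZero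

/-- And its SVL bit is the parity of `x_T`. -/
theorem svlSinkBit_permInput_eq {σ : Equiv.Perm (Fin (2 ^ m))} (hσ : NoReturn T σ) :
    svlSinkBit m T (permInput T σ) = sinkOdd T σ :=
  svlSinkBit_permInput hσ.atZero

/-- The input bit at an S-table position is the corresponding bit of `σ`. -/
theorem permInput_succIndex (σ : Equiv.Perm (Fin (2 ^ m))) (x : Fin (2 ^ m)) (j : Fin m) :
    permInput T σ (svlSuccIndex m T x j) = (σ x).val.testBit j.val := by
  show svlSuccBit (permInput T σ) x j = _
  rw [permInput, svlSuccBit_svlInput]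

/-- The input bit at a V-table position is the line indicator. -/
theorem permInput_verifyIndex (σ : Equiv.Perm (Fin (2 ^ m))) (x : Fin (2 ^ m)) (i : Fin (T + 1)) :
    permInput T σ (svlVerifyIndex m T x i) = decide (x = pt σ i.val) :=
  svlVerify_permInput σ x i

/-- **Which S-bits can differ under a swap (proved)**: only bits of the rows `x_k` and `v`
(`transpose_apply_of_ne`). -/
theorem succ_ne_imp {σ : Equiv.Perm (Fin (2 ^ m))} {k : ℕ} {v r : Fin (2 ^ m)} {b : Fin m}
    (h : permInput T σ (svlSuccIndex m T r b) ≠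
      permInput T (transpose σ (pt σ k) v) (svlSuccIndex m T r b)) :
    r = pt σ k ∨ r = v := by
  by_contra hne
  push Not at hne
  apply h
  rw [permInput_succIndex, permInput_succIndex, transpose_apply_of_ne σ hne.1 hne.2]

/-- **Which V-bits can differ under a swap (proved)**: only cells `(w, j)` with `j > k` (the lines agree up
to the cut) and `w ∈ {x_j, x'_j}` (a cell differs iff exactly one of the two lines passes through it). -/
theorem verify_ne_imp {σ : Equiv.Perm (Fin (2 ^ m))} (hσ : NoReturnAtZero T σ) {k : ℕ} (hk : k ≤ T)
    {v : Fin (2 ^ m)} (hv : ∀ i : ℕ, i ≤ k → v ≠ pt σ i) {w : Fin (2 ^ m)} {j : Fin (T + 1)}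
    (h : permInput T σ (svlVerifyIndex m T w j) ≠
      permInput T (transpose σ (pt σ k) v) (svlVerifyIndex m T w j)) :
    k < j.val ∧ (w = pt σ j.val ∨ w = pt (transpose σ (pt σ k) v) j.val) := by
  rw [permInput_verifyIndex, permInput_verifyIndex] at h
  constructor
  · by_contra hjk
    push Not at hjk
    rw [pt_transpose_of_le hσ hk hv j.val hjk] at h
    exact h rfl
  · by_contra hw
    push Not at hw
    obtain ⟨hw1, hw2⟩ := hw
    rw [decide_eq_false hw1, decide_eq_false hw2] at h
    exact h rfl

/-- Unpacking membership in `famX`. -/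
theorem mem_famX {t : SVLInput m T} :
    t ∈ famX m T ↔ ∃ σ : Equiv.Perm (Fin (2 ^ m)),
      (NoReturn T σ ∧ sinkOdd T σ = false) ∧ permInput T σ = t := by
  unfold famX
  simp only [Finset.mem_image, Finset.mem_filter, Finset.mem_univ, true_and]

/-- Unpacking membership in `famY`. -/
theorem mem_famY {t : SVLInput m T} :
    t ∈ famY m T ↔ ∃ σ : Equiv.Perm (Fin (2 ^ m)),
      (NoReturn T σ ∧ sinkOdd T σ = true) ∧ permInput T σ = t := by
  unfold famY
  simp only [Finset.mem_image, Finset.mem_filter, Finset.mem_univ, true_and]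

/-- Unpacking membership in `rel`. -/
theorem mem_rel {p : SVLInput m T × SVLInput m T} :
    p ∈ rel m T ↔ ∃ σ σ' : Equiv.Perm (Fin (2 ^ m)), IsSwap T σ σ' ∧
      sinkOdd T σ = false ∧ sinkOdd T σ' = true ∧ p = (permInput T σ, permInput T σ') := by
  unfold rel
  simp only [Finset.mem_image, Finset.mem_filter, Finset.mem_univ, true_and, Prod.exists]
  constructor
  · rintro ⟨σ, σ', ⟨h1, h2, h3⟩, h4⟩
    exact ⟨σ, σ', h1, h2, h3, h4.symm⟩
  · rintro ⟨σ, σ', h1, h2, h3, h4⟩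
    exact ⟨σ, σ', ⟨h1, h2, h3⟩, h4.symm⟩

/-- A swap pair, read off its membership in `rel`, with its parameters. -/
theorem mem_rel_params {p : SVLInput m T × SVLInput m T} (hp : p ∈ rel m T) :
    ∃ σ : Equiv.Perm (Fin (2 ^ m)), ∃ k : ℕ, ∃ v : Fin (2 ^ m),
      NoReturn T σ ∧ NoReturn T (transpose σ (pt σ k) v) ∧ k < T ∧ (∀ i : ℕ, i ≤ k → v ≠ pt σ i) ∧
        sinkOdd T σ = false ∧ sinkOdd T (transpose σ (pt σ k) v) = true ∧
          p = (permInput T σ, permInput T (transpose σ (pt σ k) v)) := by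
  obtain ⟨σ, σ', ⟨hσ, hσ', k, hk, v, hv, rfl⟩, h0, h1, rfl⟩ := mem_rel.1 hp
  exact ⟨σ, k, v, hσ, hσ', hk, hv, h0, h1, rfl⟩

/-- **Well-formedness (proved, no stub).** Every pair of `rel` joins an `X`-instance to a `Y`-instance,
both in the promise set, with sink bits `false` / `true`. -/
theorem rel_wellFormed (m T : ℕ) : ∀ p ∈ rel m T,
    p.1 ∈ famX m T ∧ p.2 ∈ famY m T ∧ p.1 ∈ svlPromise m T ∧ p.2 ∈ svlPromise m T ∧
      svlSinkBit m T p.1 = false ∧ svlSinkBit m T p.2 = true := by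
  intro p hp
  obtain ⟨σ, σ', hsw, h0, h1, rfl⟩ := mem_rel.1 hp
  have hσ : NoReturn T σ := hsw.1
  have hσ' : NoReturn T σ' := hsw.2.1
  refine ⟨?_, ?_, permInput_mem_of_noReturn hσ, permInput_mem_of_noReturn hσ', ?_, ?_⟩
  · exact mem_famX.2 ⟨σ, ⟨hσ, h0⟩, rfl⟩
  · exact mem_famY.2 ⟨σ', ⟨hσ', h1⟩, rfl⟩
  · show svlSinkBit m T (permInput T σ) = false
    rw [svlSinkBit_permInput_eq hσ, h0]
  · show svlSinkBit m T (permInput T σ') = true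
    rw [svlSinkBit_permInput_eq hσ', h1]

/-! ### Bridge to the LANDED adversary datum (`Negative/AdversaryDatum.lean`, p77173: `LC`, `Xp`, `Yp`, `Adj`, `Rp`)

The disprover's landing lane (`AdversaryDatum → Line → Acquire → Degree → Bound`) states its counts at the
PERMUTATION level over `Rp ⊆ Xp × Yp`. The identifications below (all proved) make every such count
transfer mechanically to this file's input-level `rel` / `famX` / `famY` (and back), together with the
landed commutation lemma `Adversary.card_filter_image_fst`; see `ldeg_eq_card_Rp` etc. in §2. -/

/-- `IsSwap` = both in `P'_T` + the landed `Adj`. -/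
theorem isSwap_iff_adj {σ σ' : Equiv.Perm (Fin (2 ^ m))} :
    IsSwap T σ σ' ↔ NoReturn T σ ∧ NoReturn T σ' ∧ Adj T σ σ' := by
  unfold IsSwap Adj pt
  constructor
  · rintro ⟨h1, h2, k, hk, v, hv, h3⟩
    exact ⟨h1, h2, k, hk, v, fun j hj => (hv j hj).symm, h3⟩
  · rintro ⟨h1, h2, k, hk, v, hv, h3⟩
    exact ⟨h1, h2, k, hk, v, fun j hj => (hv j hj).symm, h3⟩

/-- `sinkOdd` is the landed `sinkParity` read as a Boolean. -/
theorem sinkOdd_eq_decide (σ : Equiv.Perm (Fin (2 ^ m))) :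
    sinkOdd T σ = decide (sinkParity T σ = 1) := rfl

theorem sinkOdd_eq_false_of_mem_Xp {σ : Equiv.Perm (Fin (2 ^ m))} (h : σ ∈ Xp m T) :
    sinkOdd T σ = false := by
  unfold Xp at h
  rw [Finset.mem_filter] at h
  unfold sinkParity at h
  unfold sinkOdd pt
  rw [decide_eq_false_iff_not]
  omega

theorem sinkOdd_eq_true_of_mem_Yp {σ : Equiv.Perm (Fin (2 ^ m))} (h : σ ∈ Yp m T) :
    sinkOdd T σ = true := by
  unfold Yp at h
  rw [Finset.mem_filter] at h
  unfold sinkParity at h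
  unfold sinkOdd pt
  rw [decide_eq_true_iff]
  exact h.2

theorem mem_Xp_of {σ : Equiv.Perm (Fin (2 ^ m))} (hσ : NoReturn T σ) (h0 : sinkOdd T σ = false) :
    σ ∈ Xp m T := by
  unfold Xp
  rw [Finset.mem_filter, mem_LC_iff]
  refine ⟨hσ, ?_⟩
  unfold sinkOdd pt at h0
  unfold sinkParity
  rw [decide_eq_false_iff_not] at h0
  omega

theorem mem_Yp_of {σ : Equiv.Perm (Fin (2 ^ m))} (hσ : NoReturn T σ) (h1 : sinkOdd T σ = true) :
    σ ∈ Yp m T := by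
  unfold Yp
  rw [Finset.mem_filter, mem_LC_iff]
  refine ⟨hσ, ?_⟩
  unfold sinkOdd pt at h1
  unfold sinkParity
  rw [decide_eq_true_iff] at h1
  exact h1

/-- `famX` is the image of the landed `Xp` under the encoding. -/
theorem famX_eq_image_Xp (m T : ℕ) : famX m T = (Xp m T).image (permInput T) := by
  ext t
  rw [mem_famX, Finset.mem_image]
  constructor
  · rintro ⟨σ, ⟨hσ, h0⟩, rfl⟩
    exact ⟨σ, mem_Xp_of hσ h0, rfl⟩
  · rintro ⟨σ, hX, rfl⟩
    exact ⟨σ, ⟨noReturn_of_mem_Xp hX, sinkOdd_eq_false_of_mem_Xp hX⟩, rfl⟩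

/-- `famY` is the image of the landed `Yp` under the encoding. -/
theorem famY_eq_image_Yp (m T : ℕ) : famY m T = (Yp m T).image (permInput T) := by
  ext t
  rw [mem_famY, Finset.mem_image]
  constructor
  · rintro ⟨σ, ⟨hσ, h1⟩, rfl⟩
    exact ⟨σ, mem_Yp_of hσ h1, rfl⟩
  · rintro ⟨σ, hY, rfl⟩
    exact ⟨σ, ⟨noReturn_of_mem_Yp hY, sinkOdd_eq_true_of_mem_Yp hY⟩, rfl⟩

/-- **`rel` is the image of the landed `Rp` under the encoding** (pairs of permutations ↦ pairs of
input strings). -/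
theorem rel_eq_image_Rp (m T : ℕ) :
    rel m T = (Rp m T).image (Prod.map (permInput T) (permInput T)) := by
  ext p
  rw [mem_rel, Finset.mem_image]
  constructor
  · rintro ⟨σ, σ', hsw, h0, h1, rfl⟩
    obtain ⟨hσ, hσ', hadj⟩ := isSwap_iff_adj.1 hsw
    exact ⟨(σ, σ'), mem_Rp_iff.2 ⟨mem_Xp_of hσ h0, mem_Yp_of hσ' h1, hadj⟩, rfl⟩
  · rintro ⟨⟨σ, σ'⟩, hp, rfl⟩
    obtain ⟨hX, hY, hadj⟩ := mem_Rp_iff.1 hp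
    exact ⟨σ, σ', isSwap_iff_adj.2 ⟨noReturn_of_mem_Xp hX, noReturn_of_mem_Yp hY, hadj⟩,
      sinkOdd_eq_false_of_mem_Xp hX, sinkOdd_eq_true_of_mem_Yp hY, rfl⟩

end Family

/-! ## §2 Degrees; the adversary theorem is LANDED (`WeightedAdversary.sqrt_le_quantumQueryComplexityOn`) -/

section Degrees

variable {m T : ℕ}

/-- Left degree of `x` in `R` (number of partners of `x` as a left end) — the shape of the degree
hypotheses of the landed `sqrt_le_quantumQueryComplexityOn`. -/
def ldeg {n : ℕ} (R : Rel n) (x : Fin n → Bool) : ℕ := (R.filter fun e => e.1 = x).card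

/-- Right degree of `y` in `R`. -/
def rdeg {n : ℕ} (R : Rel n) (y : Fin n → Bool) : ℕ := (R.filter fun e => e.2 = y).card

/-- **Degrees at the permutation level** (via the landed `Adversary.card_filter_image_fst`): the
left degree of `permInput T σ` in `rel` is the number of `Rp`-partners of `σ`. -/
theorem ldeg_eq_card_Rp (σ : Equiv.Perm (Fin (2 ^ m))) :
    ldeg (rel m T) (permInput T σ) = ((Rp m T).filter fun q => q.1 = σ).card := by
  unfold ldeg
  rw [rel_eq_image_Rp]
  exact card_filter_image_fst (Rp m T) (fun q => q.1 = σ) (fun e => e.1 = permInput T σ)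
    (fun q => show permInput T q.1 = permInput T σ ↔ q.1 = σ from permInput_injective.eq_iff)

/-- Right degrees likewise. -/
theorem rdeg_eq_card_Rp (σ : Equiv.Perm (Fin (2 ^ m))) :
    rdeg (rel m T) (permInput T σ) = ((Rp m T).filter fun q => q.2 = σ).card := by
  unfold rdeg
  rw [rel_eq_image_Rp]
  exact card_filter_image_fst (Rp m T) (fun q => q.2 = σ) (fun e => e.2 = permInput T σ)
    (fun q => show permInput T q.2 = permInput T σ ↔ q.2 = σ from permInput_injective.eq_iff)

/-- **Ambainis's `l1` at the permutation level**: partners of `σ` in `Rp` whose instance differs from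
`σ`'s at input bit `i`. -/
theorem l1_eq_card_Rp (σ : Equiv.Perm (Fin (2 ^ m))) (i : Fin (2 ^ m * m + 2 ^ m * (T + 1))) :
    l1 (rel m T) (permInput T σ) i =
      ((Rp m T).filter fun q => q.1 = σ ∧ permInput T q.1 i ≠ permInput T q.2 i).card := by
  unfold l1
  rw [rel_eq_image_Rp]
  exact card_filter_image_fst (Rp m T) (fun q => q.1 = σ ∧ permInput T q.1 i ≠ permInput T q.2 i)
    (fun e => e.1 = permInput T σ ∧ e.1 i ≠ e.2 i)
    (fun q => show (permInput T q.1 = permInput T σ ∧ permInput T q.1 i ≠ permInput T q.2 i) ↔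
        (q.1 = σ ∧ permInput T q.1 i ≠ permInput T q.2 i) from
      and_congr_left' permInput_injective.eq_iff)

/-- **Ambainis's `l2` at the permutation level.** -/
theorem l2_eq_card_Rp (σ : Equiv.Perm (Fin (2 ^ m))) (i : Fin (2 ^ m * m + 2 ^ m * (T + 1))) :
    l2 (rel m T) (permInput T σ) i =
      ((Rp m T).filter fun q => q.2 = σ ∧ permInput T q.1 i ≠ permInput T q.2 i).card := by
  unfold l2
  rw [rel_eq_image_Rp]
  exact card_filter_image_fst (Rp m T) (fun q => q.2 = σ ∧ permInput T q.1 i ≠ permInput T q.2 i)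
    (fun e => e.2 = permInput T σ ∧ e.1 i ≠ e.2 i)
    (fun q => show (permInput T q.2 = permInput T σ ∧ permInput T q.1 i ≠ permInput T q.2 i) ↔
        (q.2 = σ ∧ permInput T q.1 i ≠ permInput T q.2 i) from
      and_congr_left' permInput_injective.eq_iff)

/-- **Total degree, left (proved)**: an instance has at most `T · N` partners — they are all of the form
`transpose σ x_k v` with `k < T`, `v` a name. (The `≤ T·N` factor of stub C_V.) -/
theorem ldeg_le (σ : Equiv.Perm (Fin (2 ^ m))) : ldeg (rel m T) (permInput T σ) ≤ T * 2 ^ m := by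
  have hsub : (rel m T).filter (fun e => e.1 = permInput T σ) ⊆
      ((Finset.range T) ×ˢ (Finset.univ : Finset (Fin (2 ^ m)))).image
        (fun kv : ℕ × Fin (2 ^ m) => (permInput T σ, permInput T (transpose σ (pt σ kv.1) kv.2))) := by
    intro e he
    rw [Finset.mem_filter] at he
    obtain ⟨he, he1⟩ := he
    obtain ⟨σ₁, k, v, -, -, hk, -, -, -, rfl⟩ := mem_rel_params he
    have hσ₁ : σ₁ = σ := permInput_injective he1
    subst hσ₁
    exact Finset.mem_image.2 ⟨(k, v), Finset.mem_product.2 ⟨Finset.mem_range.2 hk, Finset.mem_univ _⟩, rfl⟩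
  calc ldeg (rel m T) (permInput T σ)
      ≤ (((Finset.range T) ×ˢ (Finset.univ : Finset (Fin (2 ^ m)))).image
          (fun kv : ℕ × Fin (2 ^ m) =>
            (permInput T σ, permInput T (transpose σ (pt σ kv.1) kv.2)))).card :=
        Finset.card_le_card hsub
    _ ≤ ((Finset.range T) ×ˢ (Finset.univ : Finset (Fin (2 ^ m)))).card := Finset.card_image_le
    _ = T * 2 ^ m := by
        rw [Finset.card_product, Finset.card_range, Finset.card_univ, Fintype.card_fin]

/-- **Total degree, right (proved)**: by symmetry of the relation (`isSwap_symm`), the partners INTO an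
instance are also of the form `transpose σ x_k v`, `k < T`. -/
theorem rdeg_le (σ : Equiv.Perm (Fin (2 ^ m))) : rdeg (rel m T) (permInput T σ) ≤ T * 2 ^ m := by
  have hsub : (rel m T).filter (fun e => e.2 = permInput T σ) ⊆
      ((Finset.range T) ×ˢ (Finset.univ : Finset (Fin (2 ^ m)))).image
        (fun kv : ℕ × Fin (2 ^ m) => (permInput T (transpose σ (pt σ kv.1) kv.2), permInput T σ)) := by
    intro e he
    rw [Finset.mem_filter] at he
    obtain ⟨he, he2⟩ := he
    obtain ⟨σ₁, σ₂, hsw, -, -, rfl⟩ := mem_rel.1 he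
    have hσ₂ : σ₂ = σ := permInput_injective he2
    subst hσ₂
    obtain ⟨-, -, k, hk, v, -, rfl⟩ := isSwap_symm hsw
    exact Finset.mem_image.2 ⟨(k, v), Finset.mem_product.2 ⟨Finset.mem_range.2 hk, Finset.mem_univ _⟩, rfl⟩
  calc rdeg (rel m T) (permInput T σ)
      ≤ (((Finset.range T) ×ˢ (Finset.univ : Finset (Fin (2 ^ m)))).image
          (fun kv : ℕ × Fin (2 ^ m) =>
            (permInput T (transpose σ (pt σ kv.1) kv.2), permInput T σ))).card :=
        Finset.card_le_card hsub
    _ ≤ ((Finset.range T) ×ˢ (Finset.univ : Finset (Fin (2 ^ m)))).card := Finset.card_image_le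
    _ = T * 2 ^ m := by
        rw [Finset.card_product, Finset.card_range, Finset.card_univ, Fintype.card_fin]

end Degrees

/-! ## §3 Stubs B, C_S, C_V — the three swap COUNTS on `P'_T` (regime `8T ≤ 2^m`) -/

section Combinatorics

/-- `d* = T · N / 8`: the min-degree bound of Disproof §7.1 (`T (N/2 - 2T - 1) ≥ TN/8` once `8T ≤ N`). -/
def dstar (m T : ℕ) : ℝ := (T : ℝ) * 2 ^ m / 8

/-- **Stub B signature `Sig.stub_swapDegrees` (both sides nonempty; min degree `≥ T·N/8`).** For `1 ≤ T`,
`8T ≤ 2^m`: `famX`, `famY` are nonempty, every `t ∈ famX` is the left end of `≥ dstar` pairs of `rel` and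
every `t ∈ famY` the right end of `≥ dstar` pairs. Informal proof (Disproof §7.1 "degrees"): fix `σ ∈ P'_T`
with even sink and a cut `k < T`; for `v` NOT on the `0`-cycle `C₀` (length `L > T`) the partner
`transpose σ x_k v` merges `C₀` with the cycle of `v` — it stays in `P'_T` by the LANDED
`PermInstances.noReturn_transpose_of_not_sameCycle` — and has sink `σ^{T-k}(v)` (`sink_transpose`,
proved), a bijection of `[N] ∖ C₀`; for `v = x_q` with `k + T < q < k + L - T` it splits `C₀` into two
cycles both `> T` (LANDED `noReturn_transpose`: neither `x_k` reaches `x_q` nor `x_q` reaches `x_k` within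
`T` steps) with sink `x_{q+T-k}`, `q + T - k` ranging over `(2T, L)`; so the sinks of the cut-`k` partners
cover `[N] ∖ {x_0, …, x_{2T}}`, which contains `≥ N/2 - 2T - 1 ≥ N/8` ODD names (`N ≥ 8T`, `N ≥ 8`); distinct
`(k, v)` give distinct partners (`σ⁻¹ σ' = swap(x_k, v)` with `x_k` on and `v` off the line); `T` cuts ⇒
`≥ T·N/8`. Odd side: partners INTO `t ∈ famY` are swaps OF it (`isSwap_symm`), same count with "even".
Nonempty: the `N`-cycle `i ↦ i + 1` is in `P'_T` (`N > T`) and it or its `swap(x_{T-1}, T+1)`-partner has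
each sink parity. Why it might fail: only by a slip in the parity bookkeeping at the smallest `N`
(`N = 8`, `T = 1`: derangements, `≥ 3` partners `≥ dstar = 1`, checked exhaustively). Brute force in
EXACTLY this formulation (gen-1 `swap_stub_check.py`, kit j011073; N ≤ 512): min degree / dstar ∈ [2.0, 3.85],
`(k, v) ↦ partner` injective, 0 violations; four earlier campaigns (j008991, j009601, j009689, j009780). -/
def Sig.stub_swapDegrees : Prop :=
  ∀ m T : ℕ, 1 ≤ T → 8 * T ≤ 2 ^ m →
    (famX m T).Nonempty ∧ (famY m T).Nonempty ∧
      (∀ t ∈ famX m T, dstar m T ≤ (ldeg (rel m T) t : ℝ)) ∧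
        ∀ t ∈ famY m T, dstar m T ≤ (rdeg (rel m T) t : ℝ)

/-- **Stub B** (size M: the sink bijection `v ↦ σ^{T-k}(v)` off the `0`-cycle / along it, family
preservation by the landed `noReturn_transpose(_of_not_sameCycle)`, parity counting in `Fin (2^m)`,
injectivity of `(k, v) ↦ transpose σ x_k v`). -/
theorem stub_swapDegrees : Sig.stub_swapDegrees := by
  sorry

/-- **Stub C_S signature `Sig.stub_swapRows` (S-table positions).** For `1 ≤ T`, `8T ≤ 2^m`, every pair
`(x, y) ∈ rel m T` and every S-table bit `(r, b)` at which `x` and `y` differ: `l1 · l2 ≤ N²`. Informal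
proof: by `succ_ne_imp` (proved) `r ∈ {x_k, v}`. Row `x_k` (`= y_k`, on both lines at level `k < T`): a
partner of `x` differs there iff its cut is `k` (a TARGET `v' = x_k` would need a cut `k' < k` and would
split off the short cycle `(x_{k'+1} … x_k)`, impossible in `P'_T`), so `l1 ≤ N`; likewise `l2 ≤ N` from
`y`'s side (`isSwap_symm`). Row `v`: `v` is off BOTH lines up to level `T` (on `x`'s side a hit
`v = x_{k'}`, `k' ≤ T`, would excise a cycle of length `≤ T`; on `y`'s side `v` sits at position
`k + |C_v| > T` of the merged cycle, resp. on the excised cycle), so a partner differs at row `v` iff its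
target is `v`: one per cut, `l1, l2 ≤ T ≤ N/8`. Products `≤ N²`. Why it might fail: only if a row other
than `x_k`, `v` could differ — excluded by `succ_ne_imp`. Brute force (j011073): max S-bit product / N²
≤ 0.24. -/
def Sig.stub_swapRows : Prop :=
  ∀ m T : ℕ, 1 ≤ T → 8 * T ≤ 2 ^ m →
    ∀ e ∈ rel m T, ∀ (r : Fin (2 ^ m)) (b : Fin m),
      e.1 (svlSuccIndex m T r b) ≠ e.2 (svlSuccIndex m T r b) →
        (l1 (rel m T) e.1 (svlSuccIndex m T r b) : ℝ) * l2 (rel m T) e.2 (svlSuccIndex m T r b) ≤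
          (2 : ℝ) ^ m * 2 ^ m

/-- **Stub C_S** (size M: counting the partners through a given row by their parameters `(k', v')`;
tools `succ_ne_imp`, `mem_rel_params`, `isSwap_symm`, `pt_injOn`, `Finset.card_le_card_of_injOn`). -/
theorem stub_swapRows : Sig.stub_swapRows := by
  sorry

/-- **Stub C_V signature `Sig.stub_swapCells` (V-table positions) — the HARDEST stub.** For `1 ≤ T`,
`8T ≤ 2^m`, every pair `(x, y) ∈ rel m T` and every V-table bit `(w, j)` at which they differ:
`l1 · l2 ≤ 4 T² N`. Informal proof. By `verify_ne_imp` (proved) `j > k` and `w ∈ {x_j, y_j}`, and by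
`pt_transpose_ne` (proved) `x_j ≠ y_j`. If `w = x_j` (`x` has the `1`): `x`'s partners differing there
number `l1 ≤ ldeg ≤ T·N` (`ldeg_le`, proved); `y`'s partners `x'` differing there are the swaps OF `y`
(`isSwap_symm`) whose line passes through `w` at level `j`, i.e. (anatomy `pt_transpose_add`, proved,
applied to the pair `(y, x')`) cut `k' < j` and `y^{j-k'}(v') = w`: the target `v' = y^{-(j-k')}(w)` is
determined by the cut, so `l2 ≤ j ≤ T`. If `w = y_j`: symmetrically `l1 ≤ T` (acquirers among the
partners of `x`: `v' = x^{-(j-k')}(w)`), `l2 ≤ rdeg ≤ T·N` (`rdeg_le`). Products `≤ T²N ≤ 4T²N` (slack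
kept). This is where "absorb a short cycle and shift" would re-mark cells if cycles `≤ T` were allowed
(Disproof §7.1) — excluded by `P'_T`. Why it might fail: only if two different cuts `k' < k'' < j` with
their forced targets could BOTH be legal partners re-marking the same cell more than once per cut — they
cannot: one target per cut is an injection `acquirers ↪ {k' < j}`. Brute force: max acquisitions `= j`
exactly (triage r1-1 swap_counts.py; j009689; j009780; j011073: max V-bit product / (T²N) ≤ 0.50). -/
def Sig.stub_swapCells : Prop :=
  ∀ m T : ℕ, 1 ≤ T → 8 * T ≤ 2 ^ m →
    ∀ e ∈ rel m T, ∀ (w : Fin (2 ^ m)) (j : Fin (T + 1)),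
      e.1 (svlVerifyIndex m T w j) ≠ e.2 (svlVerifyIndex m T w j) →
        (l1 (rel m T) e.1 (svlVerifyIndex m T w j) : ℝ) * l2 (rel m T) e.2 (svlVerifyIndex m T w j) ≤
          4 * (T : ℝ) ^ 2 * 2 ^ m

/-- **Stub C_V** (size M: the one-target-per-cut ACQUISITION injection `x' ↦ its cut k' < j`, built on the
proved anatomy `pt_transpose_add` / `verify_ne_imp` / `pt_transpose_ne` and the proved totals `ldeg_le` /
`rdeg_le`; `Equiv.Perm` powers and `Equiv.injective` for "the target is determined by the cut"). -/
theorem stub_swapCells : Sig.stub_swapCells := by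
  sorry

end Combinatorics

/-! ## §4 From the stubs to Disproof's Target A (`SvlAdversarySmallT`) — proved, adversary theorem LANDED -/

section SmallT

/-- `L* = max (N², 4 T² N)`: the per-pair per-bit product bound assembled from C_S and C_V. -/
def Lstar (m T : ℕ) : ℝ := max ((2 : ℝ) ^ m * 2 ^ m) (4 * (T : ℝ) ^ 2 * 2 ^ m)

/-- Every input position is an S-table position or a V-table position. -/
theorem fin_add_cases {a b : ℕ} (i : Fin (a + b)) :
    (∃ i₁ : Fin a, i = Fin.castAdd b i₁) ∨ ∃ i₂ : Fin b, i = Fin.natAdd a i₂ := by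
  by_cases h : i.val < a
  · exact Or.inl ⟨⟨i.val, h⟩, Fin.ext rfl⟩
  · refine Or.inr ⟨⟨i.val - a, by omega⟩, Fin.ext ?_⟩
    simp only [Fin.val_natAdd]
    omega

/-- **C_S + C_V ⇒ Ambainis's product hypothesis at every input bit** (proved). -/
theorem productBound_of (hS : Sig.stub_swapRows) (hV : Sig.stub_swapCells) {m T : ℕ} (hT : 1 ≤ T)
    (h8 : 8 * T ≤ 2 ^ m) :
    ∀ e ∈ rel m T, ∀ i : Fin (2 ^ m * m + 2 ^ m * (T + 1)), e.1 i ≠ e.2 i →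
      (l1 (rel m T) e.1 i : ℝ) * l2 (rel m T) e.2 i ≤ Lstar m T := by
  intro e he i hi
  rcases fin_add_cases i with ⟨i₁, rfl⟩ | ⟨i₂, rfl⟩
  · -- S-table position: `i₁ = finProdFinEquiv (r, b)`
    have hidx : Fin.castAdd (2 ^ m * (T + 1)) i₁ =
        svlSuccIndex m T (finProdFinEquiv.symm i₁).1 (finProdFinEquiv.symm i₁).2 := by
      rw [svlSuccIndex, Prod.mk.eta, Equiv.apply_symm_apply]
    rw [hidx] at hi ⊢
    exact (hS m T hT h8 e he _ _ hi).trans (le_max_left _ _)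
  · -- V-table position: `i₂ = finProdFinEquiv (w, j)`
    have hidx : Fin.natAdd (2 ^ m * m) i₂ =
        svlVerifyIndex m T (finProdFinEquiv.symm i₂).1 (finProdFinEquiv.symm i₂).2 := by
      rw [svlVerifyIndex, Prod.mk.eta, Equiv.apply_symm_apply]
    rw [hidx] at hi ⊢
    exact (hV m T hT h8 e he _ _ hi).trans (le_max_right _ _)

/-- **Disproof's Target A** (`Disproof.lean` §7, verbatim): the relational-adversary lower bound for
black-box SVL on long-cycle permutation instances in the regime `8T ≤ 2^m`. -/
def SvlAdversarySmallT : Prop :=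
  ∃ κ : ℝ, 0 < κ ∧ ∀ m T : ℕ, 1 ≤ T → 8 * T ≤ 2 ^ m →
    κ * min (T : ℝ) (Real.sqrt (2 ^ m)) ≤ (svlQ m T : ℝ)

/-- **B + C_S + C_V ⇒ `SvlAdversarySmallT`** with `κ = 1/2304 = 1/(16·144)` (proved): the LANDED
`sqrt_le_quantumQueryComplexityOn` (Ambainis Thm 6, `√(m₀ m₁/ℓ) ≤ 144·Q`) with `m₀ = m₁ = d*`, `ℓ = L*`
gives `d* ≤ 144·Q·√L*`, and `d*/√L* = (TN/8)/max(N, 2T√N) = min(T/8, √N/16)`. -/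
theorem smallT_of_stubs (hB : Sig.stub_swapDegrees) (hS : Sig.stub_swapRows)
    (hV : Sig.stub_swapCells) : SvlAdversarySmallT := by
  refine ⟨1 / (16 * 144), by positivity, fun m T hT h8 => ?_⟩
  have h16C : (16 * 144 : ℝ) ≠ 0 := by norm_num
  obtain ⟨hXne, hYne, hdX, hdY⟩ := hB m T hT h8
  have hWF := rel_wellFormed m T
  have hLpos : 0 < Lstar m T := lt_of_lt_of_le (by positivity) (le_max_left _ _)
  -- `rel` is nonempty: an `X`-instance exists and has positive degree (`1 ≤ T` at work)
  have hd0 : 0 < dstar m T := by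
    unfold dstar
    have : (1 : ℝ) ≤ T := by exact_mod_cast hT
    positivity
  have hRne : (rel m T).Nonempty := by
    obtain ⟨t, ht⟩ := hXne
    have h1 : (0 : ℝ) < (ldeg (rel m T) t : ℝ) := lt_of_lt_of_le hd0 (hdX t ht)
    have h2 : 0 < ldeg (rel m T) t := by exact_mod_cast h1
    obtain ⟨e, he⟩ := Finset.card_pos.1 h2
    exact ⟨e, (Finset.mem_filter.1 he).1⟩
  -- the LANDED adversary theorem
  have hmain := sqrt_le_quantumQueryComplexityOn (D := svlPromise m T) (f := svlSinkBit m T)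
    (rel m T) hRne
    (fun e he => ⟨(hWF e he).2.2.1, (hWF e he).2.2.2.1⟩)
    (fun e he => by rw [(hWF e he).2.2.2.2.1, (hWF e he).2.2.2.2.2]; decide)
    hd0 hd0 hLpos
    (fun e he => hdX e.1 (hWF e he).1) (fun e he => hdY e.2 (hWF e he).2.1)
    (productBound_of hS hV hT h8)
  -- `√(d* d* / L*) ≤ 144 Q`, i.e. `d* ≤ 144 Q √L*`
  have hsL : 0 < Real.sqrt (Lstar m T) := Real.sqrt_pos.2 hLpos
  rw [Real.sqrt_div' _ hLpos.le, Real.sqrt_mul_self hd0.le, div_le_iff₀ hsL] at hmain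
  have hkey : dstar m T ≤ 144 * (svlQ m T : ℝ) * Real.sqrt (Lstar m T) := hmain
  -- unpack `dstar`, `Lstar`
  set q : ℝ := (svlQ m T : ℝ) with hq
  have hq0 : 0 ≤ q := by positivity
  have hCq : 0 ≤ 144 * q := by positivity
  have hNpos : (0 : ℝ) < 2 ^ m := by positivity
  set s : ℝ := Real.sqrt (2 ^ m) with hs
  have hsqN : 0 < s := Real.sqrt_pos.2 hNpos
  have hss : s * s = 2 ^ m := Real.mul_self_sqrt hNpos.le
  have hT1 : (1 : ℝ) ≤ T := by exact_mod_cast hT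
  have hTpos : (0 : ℝ) < T := by linarith
  unfold dstar Lstar at hkey
  rcases le_total ((2 : ℝ) ^ m * 2 ^ m) (4 * (T : ℝ) ^ 2 * 2 ^ m) with hle | hle
  · -- Grover branch: `L* = 4 T² N`, `√L* = 2 T s`
    rw [max_eq_right hle] at hkey
    have hsqrtL : Real.sqrt (4 * (T : ℝ) ^ 2 * 2 ^ m) = 2 * (T : ℝ) * s := by
      rw [show (4 : ℝ) * (T : ℝ) ^ 2 * 2 ^ m = (2 * (T : ℝ)) ^ 2 * 2 ^ m by ring,
        Real.sqrt_mul (by positivity), Real.sqrt_sq (by positivity)]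
    rw [hsqrtL, ← hss] at hkey
    -- `hkey : T (s s) / 8 ≤ 144 q (2 T s)`; cancel `T s > 0`
    have hTs : 0 < (T : ℝ) * s := mul_pos hTpos hsqN
    have h2 : (T : ℝ) * s * s ≤ (T : ℝ) * s * (16 * 144 * q) := by nlinarith [hkey]
    have h1 : s ≤ 16 * 144 * q := le_of_mul_le_mul_left h2 hTs
    calc 1 / (16 * 144) * min (T : ℝ) s ≤ 1 / (16 * 144) * s := by
          gcongr
          exact min_le_right _ _
      _ ≤ 1 / (16 * 144) * (16 * 144 * q) := by gcongr
      _ = q := by rw [one_div, inv_mul_cancel_left₀ h16C]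
  · -- walk branch: `L* = N²`, `√L* = N`
    rw [max_eq_left hle] at hkey
    have hsqrtL : Real.sqrt ((2 : ℝ) ^ m * 2 ^ m) = 2 ^ m := Real.sqrt_mul_self hNpos.le
    rw [hsqrtL] at hkey
    -- `hkey : T N / 8 ≤ 144 q N`; cancel `N > 0`
    have h2 : (2 : ℝ) ^ m * T ≤ (2 : ℝ) ^ m * (8 * 144 * q) := by nlinarith [hkey]
    have h1 : (T : ℝ) ≤ 8 * 144 * q := le_of_mul_le_mul_left h2 hNpos
    have h1' : (T : ℝ) ≤ 16 * 144 * q := by nlinarith [h1, hCq]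
    calc 1 / (16 * 144) * min (T : ℝ) s ≤ 1 / (16 * 144) * T := by
          gcongr
          exact min_le_left _ _
      _ ≤ 1 / (16 * 144) * (16 * 144 * q) := by gcongr
      _ = q := by rw [one_div, inv_mul_cancel_left₀ h16C]

end SmallT

/-! ## §5 Target A ⇒ the crux (Disproof §7.3's checked reduction, padding DISCHARGED by the landed lemma) -/

section Composition

/-- **`SvlAdversarySmallT` ⇒ the crux** with `c = min(κ/2, 1/4)`: the disprover's checked
`crux_of_smallT_of_padding` (cases `8T ≤ 2^m` / `m < 7` / pad from `(m-1, 2^(m-4))`), its hypothesis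
`PaddingMonotone` supplied by the LANDED `SvlPadding.quantumQueryComplexityOn_svl_pad`, and `Q ≥ 1`
for small `m` by the LANDED `Negative.one_le_svlQ_of_hyps` (this is where `1 ≤ T` and `T + 1 ≤ 2^(m-1)`
are consumed, honouring `_false_without_Tpos` / `_false_without_Tbound`). Stated in the unfolded form of
`Negative.crux_iff` so that `WbwVerifiableLineNoSpeedup_of` is the only theorem concluding the crux by name. -/
theorem crux_of_smallT (hA : SvlAdversarySmallT) :
    ∃ c : ℝ, 0 < c ∧ ∀ m T : ℕ, 2 ≤ m → 1 ≤ T → T + 1 ≤ 2 ^ (m - 1) →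
      c * min ((T : ℝ) + 1) (Real.sqrt (2 ^ m)) / m ≤ (svlQ m T : ℝ) := by
  obtain ⟨κ, hκ, hA⟩ := hA
  refine ⟨min (κ / 2) (1 / 4), by positivity, fun m T hm hT hTm => ?_⟩
  set c : ℝ := min (κ / 2) (1 / 4) with hc
  have hc2 : c ≤ κ / 2 := min_le_left _ _
  have hc4 : c ≤ 1 / 4 := min_le_right _ _
  have hcpos : 0 < c := by positivity
  have hmR : (2 : ℝ) ≤ m := by exact_mod_cast hm
  have hm1 : (1 : ℝ) ≤ m := by linarith
  have hQ1 : (1 : ℝ) ≤ (svlQ m T : ℝ) := by exact_mod_cast one_le_svlQ_of_hyps hT hTm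
  have hN : (0 : ℝ) < Real.sqrt (2 ^ m) := Real.sqrt_pos.2 (by positivity)
  -- dividing by `m ≥ 1` only helps
  have hdiv : c * min ((T : ℝ) + 1) (Real.sqrt (2 ^ m)) / m ≤
      c * min ((T : ℝ) + 1) (Real.sqrt (2 ^ m)) := by
    rw [div_le_iff₀ (by linarith)]
    have h0 : 0 ≤ c * min ((T : ℝ) + 1) (Real.sqrt (2 ^ m)) := by positivity
    nlinarith
  by_cases h8 : 8 * T ≤ 2 ^ m
  · -- comfortable regime: adversary bound directly
    refine hdiv.trans ?_
    have hb := hA m T hT h8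
    have hmin : min ((T : ℝ) + 1) (Real.sqrt (2 ^ m)) ≤ 2 * min (T : ℝ) (Real.sqrt (2 ^ m)) := by
      have hT1 : (1 : ℝ) ≤ T := by exact_mod_cast hT
      rcases le_total (T : ℝ) (Real.sqrt (2 ^ m)) with h | h
      · rw [min_eq_left h]
        calc min ((T : ℝ) + 1) (Real.sqrt (2 ^ m)) ≤ (T : ℝ) + 1 := min_le_left _ _
          _ ≤ 2 * T := by linarith
      · rw [min_eq_right h]
        calc min ((T : ℝ) + 1) (Real.sqrt (2 ^ m)) ≤ Real.sqrt (2 ^ m) := min_le_right _ _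
          _ ≤ 2 * Real.sqrt (2 ^ m) := by linarith
    calc c * min ((T : ℝ) + 1) (Real.sqrt (2 ^ m))
        ≤ (κ / 2) * (2 * min (T : ℝ) (Real.sqrt (2 ^ m))) := by
          gcongr
      _ = κ * min (T : ℝ) (Real.sqrt (2 ^ m)) := by ring
      _ ≤ (svlQ m T : ℝ) := hb
  · push Not at h8
    -- large-T regime
    by_cases hm7 : m < 7
    · -- finitely many name lengths: `min ≤ √(2^m) ≤ √64 = 8`, `m ≥ 2`, `c ≤ 1/4`, and `Q ≥ 1`
      have hsq : Real.sqrt (2 ^ m) ≤ 8 := by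
        have : (2 : ℝ) ^ m ≤ 2 ^ 6 := pow_le_pow_right₀ (by norm_num) (by omega)
        calc Real.sqrt (2 ^ m) ≤ Real.sqrt (2 ^ 6) := Real.sqrt_le_sqrt this
          _ = 8 := by
            rw [show ((2 : ℝ) ^ 6) = 8 ^ 2 by norm_num]
            exact Real.sqrt_sq (by norm_num)
      have hnum : c * min ((T : ℝ) + 1) (Real.sqrt (2 ^ m)) ≤ 2 := by
        calc c * min ((T : ℝ) + 1) (Real.sqrt (2 ^ m)) ≤ (1 / 4) * 8 := by
              gcongr
              exact (min_le_right _ _).trans hsq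
          _ = 2 := by norm_num
      calc c * min ((T : ℝ) + 1) (Real.sqrt (2 ^ m)) / m ≤ 2 / m := by gcongr
        _ ≤ 1 := by rw [div_le_one (by linarith)]; exact hmR
        _ ≤ (svlQ m T : ℝ) := hQ1
    · push Not at hm7
      refine hdiv.trans ?_
      -- m ≥ 7: pad from (m-1, T' = 2^(m-4))
      obtain ⟨m', rfl⟩ : ∃ m', m = m' + 1 := ⟨m - 1, by omega⟩
      have hm'6 : 6 ≤ m' := by omega
      set T' : ℕ := 2 ^ (m' - 3) with hT'
      have hT'pos : 1 ≤ T' := Nat.one_le_two_pow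
      have h8T' : 8 * T' ≤ 2 ^ m' := by
        rw [hT', show (8 : ℕ) = 2 ^ 3 by norm_num, ← pow_add]
        exact Nat.pow_le_pow_right (by norm_num) (by omega)
      have hT'T : T' < T := by
        have : 2 ^ (m' + 1) < 8 * T := h8
        have h2 : 2 ^ (m' + 1) = 16 * 2 ^ (m' - 3) := by
          rw [show (16 : ℕ) = 2 ^ 4 by norm_num, ← pow_add]
          congr 1
          omega
        omega
      have hTle : T ≤ 2 ^ m' := by
        have := hTm
        simp only [Nat.add_sub_cancel] at this
        omega
      have hpad : svlQ m' T' ≤ svlQ (m' + 1) T :=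
        quantumQueryComplexityOn_svl_pad (by norm_num) (by omega) hT'T hTle
      have hadv := hA m' T' hT'pos h8T'
      have hQ : κ * min (T' : ℝ) (Real.sqrt (2 ^ m')) ≤ (svlQ (m' + 1) T : ℝ) :=
        hadv.trans (by exact_mod_cast hpad)
      have hkey : Real.sqrt (2 ^ (m' + 1)) ≤ 2 * min (T' : ℝ) (Real.sqrt (2 ^ m')) := by
        have hs1 : Real.sqrt (2 ^ (m' + 1)) ≤ 2 * Real.sqrt (2 ^ m') := by
          rw [show (2 : ℝ) * Real.sqrt (2 ^ m') = Real.sqrt (2 ^ 2 * 2 ^ m') by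
            rw [Real.sqrt_mul (by positivity), Real.sqrt_sq (by norm_num)]]
          exact Real.sqrt_le_sqrt (by rw [pow_succ]; nlinarith [pow_pos (by norm_num : (0:ℝ) < 2) m'])
        have hs2 : Real.sqrt (2 ^ (m' + 1)) ≤ 2 * (T' : ℝ) := by
          have hT'R : (T' : ℝ) = (2 : ℝ) ^ (m' - 3) := by rw [hT']; norm_cast
          rw [show (2 : ℝ) * T' = Real.sqrt ((2 * T') ^ 2) from (Real.sqrt_sq (by positivity)).symm]
          apply Real.sqrt_le_sqrt
          rw [hT'R, mul_pow, ← pow_mul, show (2:ℝ)^2 = 2^(2:ℕ) by norm_num, ← pow_add]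
          exact pow_le_pow_right₀ (by norm_num) (by omega)
        rcases le_total (T' : ℝ) (Real.sqrt (2 ^ m')) with h | h
        · rw [min_eq_left h]; exact hs2
        · rw [min_eq_right h]; exact hs1
      calc c * min ((T : ℝ) + 1) (Real.sqrt (2 ^ (m' + 1)))
          ≤ c * Real.sqrt (2 ^ (m' + 1)) := by gcongr; exact min_le_right _ _
        _ ≤ (κ / 2) * (2 * min (T' : ℝ) (Real.sqrt (2 ^ m'))) := by gcongr
        _ = κ * min (T' : ℝ) (Real.sqrt (2 ^ m')) := by ring
        _ ≤ (svlQ (m' + 1) T : ℝ) := hQ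

/-- **COMPOSITION (kernel-checked, no sorry): the three stub signatures imply the crux, BY NAME.**
(`Negative.crux_iff` is `Iff.rfl`: the crux literally is the `∃ c > 0, …` statement over
`svlPromise`/`svlSinkBit`; the adversary theorem and the padding lemma it also consumes are LANDED.) -/
theorem WbwVerifiableLineNoSpeedup_of :
    Sig.stub_swapDegrees → Sig.stub_swapRows → Sig.stub_swapCells →
      Summit.QuantumAdvantage.QuantumAdvantage.Theses.WhiteBoxWalk.WbwVerifiableLineNoSpeedup :=
  fun hB hS hV => crux_iff.2 (crux_of_smallT (smallT_of_stubs hB hS hV))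

end Composition

end Summit.QuantumAdvantage.QuantumAdvantage.Cruxes.WbwVerifiableLineNoSpeedup.SwapRelationalAdversary

end
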